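import Mathlib

/-!
# The W-form (blind cell PercRepro2, mine-1 g13) — definitions, the kernel-sum calculus, transport
proofs/MINE1-W-BLOCKS.md.

For a finite type `α` with a (disjointness) relation `D` and a nonnegative weight `W : α → R`, the
**W-form** of two functions `g, h : α → R` is

  `Q D W g h = ∑_{s, t : D s t} W s · W t · (g s − g t) · (h s − h t)`.

`WIneq D W` says that `Q D W g h ≥ 0` for all monotone `g, h`. For the status law
`W_S = P(C(ρ) ∩ F = S)` of a percolation cluster on `α = 2^F` with `D` = disjointness of statuses
this is the cell's W-inequality in its increasing-function form (MINE1-W-BLOCKS.md Lemma 0); it is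
EQUIVALENT to the up-set form (`wIneq_upperSet` one way, `wIneq_of_upperSets` — the layer cake —
the other). The closure theorems live in `WFormProd` (wedge at the
root) and `WFormHier` (branch at a test vertex); `wIneq_of_orderIso` transports `WIneq` along order
isomorphisms such as `2^{F₁ ⊔ F₂} ≃o 2^{F₁} × 2^{F₂}`.
-/

namespace Summit.Ventures.PercRepro2.WForm

section Defs

variable {R : Type*} [CommRing R] {α : Type*} [Fintype α]

/-- The pair coefficient `W s · W t` on related pairs, `0` otherwise. -/
def coef (D : α → α → Prop) [DecidableRel D] (W : α → R) (s t : α) : R :=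
  if D s t then W s * W t else 0

/-- The kernel sum `S X = ∑_{D s t} W s W t X s t`. -/
def S (D : α → α → Prop) [DecidableRel D] (W : α → R) (X : α → α → R) : R :=
  ∑ s, ∑ t, coef D W s t * X s t

/-- The W-form of `g, h`. -/
def Q (D : α → α → Prop) [DecidableRel D] (W g h : α → R) : R :=
  S D W (fun s t => (g s - g t) * (h s - h t))

omit [Fintype α] in
/-- The coefficient is symmetric when the relation is. -/
lemma coef_symm {D : α → α → Prop} [DecidableRel D] (hD : ∀ s t, D s t → D t s) (W : α → R)
    (s t : α) : coef D W s t = coef D W t s := by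
  unfold coef
  by_cases h : D s t
  · rw [if_pos h, if_pos (hD s t h), mul_comm]
  · rw [if_neg h, if_neg (fun h' => h (hD t s h'))]

/-- Swapping the two arguments of the kernel does not change the kernel sum. -/
lemma S_swap {D : α → α → Prop} [DecidableRel D] (hD : ∀ s t, D s t → D t s) (W : α → R)
    (X : α → α → R) : S D W X = S D W (fun s t => X t s) := by
  unfold S
  rw [Finset.sum_comm]
  refine Finset.sum_congr rfl fun s _ => Finset.sum_congr rfl fun t _ => ?_
  rw [coef_symm hD W t s]

/-- The kernel sum is additive. -/
lemma S_add (D : α → α → Prop) [DecidableRel D] (W : α → R) (X Y : α → α → R) :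
    S D W (fun s t => X s t + Y s t) = S D W X + S D W Y := by
  unfold S
  rw [← Finset.sum_add_distrib]
  refine Finset.sum_congr rfl fun s _ => ?_
  rw [← Finset.sum_add_distrib]
  refine Finset.sum_congr rfl fun t _ => ?_
  ring

/-- The kernel sum is homogeneous. -/
lemma S_smul (D : α → α → Prop) [DecidableRel D] (W : α → R) (c : R) (X : α → α → R) :
    S D W (fun s t => c * X s t) = c * S D W X := by
  unfold S
  rw [Finset.mul_sum]
  refine Finset.sum_congr rfl fun s _ => ?_
  rw [Finset.mul_sum]
  refine Finset.sum_congr rfl fun t _ => ?_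
  ring

/-- Pointwise equal kernels have equal kernel sums. -/
lemma S_congr (D : α → α → Prop) [DecidableRel D] (W : α → R) {X Y : α → α → R}
    (h : ∀ s t, X s t = Y s t) : S D W X = S D W Y := by
  unfold S
  refine Finset.sum_congr rfl fun s _ => Finset.sum_congr rfl fun t _ => ?_
  rw [h]

/-- Symmetrisation: `2 · S X` only depends on `X + X∘swap`. -/
lemma two_S_eq_of_symm {D : α → α → Prop} [DecidableRel D] (hD : ∀ s t, D s t → D t s) (W : α → R)
    (X Y : α → α → R) (h : ∀ s t, X s t + X t s = Y s t + Y t s) :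
    2 * S D W X = 2 * S D W Y := by
  have eX : S D W (fun s t => X s t + X t s) = 2 * S D W X := by
    rw [S_add, ← S_swap hD W X, two_mul]
  have eY : S D W (fun s t => Y s t + Y t s) = 2 * S D W Y := by
    rw [S_add, ← S_swap hD W Y, two_mul]
  rw [← eX, ← eY]
  exact S_congr D W h

end Defs

section Order

variable {R : Type*} [CommRing R] [LinearOrder R] [IsStrictOrderedRing R]
variable {α : Type*} [Fintype α]

/-- The W-inequality in the increasing-function form: nonnegative weights and `Q ≥ 0` on all
monotone pairs. -/
def WIneq [Preorder α] (D : α → α → Prop) [DecidableRel D] (W : α → R) : Prop :=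
  (∀ s, 0 ≤ W s) ∧ ∀ g h : α → R, Monotone g → Monotone h → 0 ≤ Q D W g h

omit [Fintype α] in
/-- Nonnegative weights give nonnegative coefficients. -/
lemma coef_nonneg (D : α → α → Prop) [DecidableRel D] {W : α → R} (hW : ∀ s, 0 ≤ W s) (s t : α) :
    0 ≤ coef D W s t := by
  unfold coef
  split_ifs
  · exact mul_nonneg (hW s) (hW t)
  · exact le_refl 0

/-- Kernel sums of nonnegative kernels against nonnegative weights are nonnegative. -/
lemma S_nonneg (D : α → α → Prop) [DecidableRel D] {W : α → R} (hW : ∀ s, 0 ≤ W s)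
    {X : α → α → R} (hX : ∀ s t, 0 ≤ X s t) : 0 ≤ S D W X := by
  unfold S
  exact Finset.sum_nonneg fun s _ => Finset.sum_nonneg fun t _ =>
    mul_nonneg (coef_nonneg D hW s t) (hX s t)


omit [Fintype α] in
/-- Indicators of upper sets are monotone. -/
lemma monotone_indicator_of_isUpperSet [Preorder α] {U : Set α} (hU : IsUpperSet U)
    [DecidablePred (· ∈ U)] : Monotone (fun s : α => if s ∈ U then (1 : R) else 0) := by
  intro s t hst
  show (if s ∈ U then (1 : R) else 0) ≤ (if t ∈ U then (1 : R) else 0)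
  by_cases hs : s ∈ U
  · rw [if_pos hs, if_pos (hU hst hs)]
  · rw [if_neg hs]
    split_ifs
    · exact zero_le_one
    · exact le_refl 0

/-- The up-set form of the W-inequality (the cell's statement for status laws) follows from
`WIneq`: `Q(1_U, 1_V) ≥ 0` for all upper sets `U, V`. -/
theorem wIneq_upperSet [Preorder α] {D : α → α → Prop} [DecidableRel D] {W : α → R}
    (h : WIneq D W) {U V : Set α} (hU : IsUpperSet U) (hV : IsUpperSet V)
    [DecidablePred (· ∈ U)] [DecidablePred (· ∈ V)] :
    0 ≤ Q D W (fun s => if s ∈ U then 1 else 0) (fun s => if s ∈ V then 1 else 0) :=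
  h.2 _ _ (monotone_indicator_of_isUpperSet hU) (monotone_indicator_of_isUpperSet hV)

end Order

section Transport

variable {R : Type*} [CommRing R] [LinearOrder R] [IsStrictOrderedRing R]
variable {α β : Type*} [Fintype α] [Fintype β] [Preorder α] [Preorder β]

omit [LinearOrder R] [IsStrictOrderedRing R] [Preorder α] [Preorder β] in
/-- The W-form is invariant under re-indexing by an equivalence. -/
lemma Q_comp_equiv (e : α ≃ β) (D : β → β → Prop) [DecidableRel D] (W g h : β → R) :
    Q (fun a a' => D (e a) (e a')) (fun a => W (e a)) (fun a => g (e a)) (fun a => h (e a)) =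
      Q D W g h := by
  unfold Q S coef
  rw [← Fintype.sum_equiv e _ _ (fun a => rfl)]
  refine Finset.sum_congr rfl fun a _ => ?_
  exact Fintype.sum_equiv e _ _ (fun a' => rfl)

omit [IsStrictOrderedRing R] in
/-- Transport of the W-inequality along an order isomorphism (e.g. `2^{F₁ ⊔ F₂} ≃o 2^{F₁} × 2^{F₂}`
for status laws). -/
theorem wIneq_of_orderIso (e : α ≃o β) (D : β → β → Prop) [DecidableRel D] (W : β → R)
    (h : WIneq (fun a a' => D (e a) (e a')) (fun a => W (e a))) : WIneq D W := by
  refine ⟨fun b => by simpa using h.1 (e.symm b), ?_⟩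
  intro g k hg hk
  rw [← Q_comp_equiv e.toEquiv D W g k]
  exact h.2 _ _ (hg.comp e.monotone) (hk.comp e.monotone)

end Transport

section LayerCake

variable {R : Type*} [CommRing R] [LinearOrder R] [IsStrictOrderedRing R]
variable {α : Type*} [Fintype α] [DecidableEq α] [Preorder α] {D : α → α → Prop} [DecidableRel D]

/-- The indicator of a finite set. -/
def ind (U : Finset α) (s : α) : R := if s ∈ U then 1 else 0

omit [LinearOrder R] [IsStrictOrderedRing R] [DecidableEq α] [Preorder α] in
/-- The W-form is symmetric in its two function arguments. -/
lemma Q_comm (W g h : α → R) : Q D W g h = Q D W h g := by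
  unfold Q
  exact S_congr D W fun s t => by ring

omit [LinearOrder R] [IsStrictOrderedRing R] [DecidableEq α] [Preorder α] in
/-- The W-form is additive in its second argument. -/
lemma Q_add_right (W g h h' : α → R) :
    Q D W g (fun s => h s + h' s) = Q D W g h + Q D W g h' := by
  unfold Q
  rw [← S_add]
  exact S_congr D W fun s t => by ring

omit [LinearOrder R] [IsStrictOrderedRing R] [DecidableEq α] [Preorder α] in
/-- The W-form is homogeneous in its second argument. -/
lemma Q_smul_right (W g : α → R) (c : R) (h : α → R) :
    Q D W g (fun s => c * h s) = c * Q D W g h := by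
  unfold Q
  rw [← S_smul]
  exact S_congr D W fun s t => by ring

omit [LinearOrder R] [IsStrictOrderedRing R] [DecidableEq α] [Preorder α] in
/-- Constants are invisible to the W-form. -/
lemma Q_const_right (W g : α → R) (c : R) : Q D W g (fun _ => c) = 0 := by
  unfold Q S
  refine Finset.sum_eq_zero fun s _ => Finset.sum_eq_zero fun t _ => ?_
  ring

omit [LinearOrder R] [IsStrictOrderedRing R] [DecidableEq α] [Preorder α] in
/-- The W-form of a function with at most one value vanishes. -/
lemma Q_eq_zero_of_card_le_one [DecidableEq R] (W g h : α → R)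
    (hc : (Finset.univ.image h).card ≤ 1) : Q D W g h = 0 := by
  by_cases hα : IsEmpty α
  · unfold Q S
    rw [Finset.univ_eq_empty, Finset.sum_empty]
  · rw [not_isEmpty_iff] at hα
    obtain ⟨a⟩ := hα
    have hconst : ∀ s, h s = h a := fun s =>
      Finset.card_le_one.mp hc (h s) (Finset.mem_image_of_mem h (Finset.mem_univ s)) (h a)
        (Finset.mem_image_of_mem h (Finset.mem_univ a))
    rw [show h = fun _ => h a from funext hconst]
    exact Q_const_right W g (h a)

/-- One layer of the layer cake: a monotone function with at least two values is a monotone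
function with fewer values plus a positive multiple of the indicator of an upper set. -/
lemma layer_step {h : α → R} (hh : Monotone h) (h2 : 2 ≤ (Finset.univ.image h).card) :
    ∃ (h' : α → R) (c : R) (V : Finset α), Monotone h' ∧
      (Finset.univ.image h').card < (Finset.univ.image h).card ∧ 0 < c ∧
      IsUpperSet (↑V : Set α) ∧ ∀ s, h s = h' s + c * ind V s := by
  set S := Finset.univ.image h with hS
  have hne : S.Nonempty := Finset.card_pos.mp (by omega)
  set M := S.max' hne with hM
  have hMmem : M ∈ S := Finset.max'_mem S hne
  set S' := S.erase M with hS'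
  have hcard' : S'.card = S.card - 1 := Finset.card_erase_of_mem hMmem
  have hne' : S'.Nonempty := Finset.card_pos.mp (by omega)
  set M' := S'.max' hne' with hM'
  have hM'mem : M' ∈ S' := Finset.max'_mem S' hne'
  have hM'S : M' ∈ S := Finset.mem_of_mem_erase hM'mem
  have hM'ne : M' ≠ M := Finset.ne_of_mem_erase hM'mem
  have hM'lt : M' < M := lt_of_le_of_ne (Finset.le_max' S M' hM'S) hM'ne
  have hleM : ∀ s, h s ≤ M := fun s => Finset.le_max' S (h s) (Finset.mem_image_of_mem h (Finset.mem_univ s))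
  have hleM' : ∀ s, h s ≠ M → h s ≤ M' := fun s hs =>
    Finset.le_max' S' (h s) (Finset.mem_erase.mpr ⟨hs, Finset.mem_image_of_mem h (Finset.mem_univ s)⟩)
  have htop : ∀ s t, s ≤ t → h s = M → h t = M := fun s t hst hs =>
    le_antisymm (hleM t) (hs ▸ hh hst)
  refine ⟨fun s => if h s = M then M' else h s, M - M', Finset.univ.filter (fun s => h s = M), ?_, ?_, ?_, ?_, ?_⟩
  · intro s t hst
    show (if h s = M then M' else h s) ≤ (if h t = M then M' else h t)
    by_cases hs : h s = M
    · rw [if_pos hs, if_pos (htop s t hst hs)]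
    · rw [if_neg hs]
      by_cases ht : h t = M
      · rw [if_pos ht]; exact hleM' s hs
      · rw [if_neg ht]; exact hh hst
  · calc (Finset.univ.image fun s => if h s = M then M' else h s).card ≤ S'.card := by
          apply Finset.card_le_card
          intro v hv
          obtain ⟨s, _, rfl⟩ := Finset.mem_image.mp hv
          by_cases hs : h s = M
          · rw [if_pos hs]; exact hM'mem
          · rw [if_neg hs]
            exact Finset.mem_erase.mpr ⟨hs, Finset.mem_image_of_mem h (Finset.mem_univ s)⟩
      _ < S.card := by omega
  · exact sub_pos.mpr hM'lt
  · intro s t hst hs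
    simp only [Finset.coe_filter, Finset.mem_univ, true_and, Set.mem_setOf_eq] at hs ⊢
    exact htop s t hst hs
  · intro s
    show h s = (if h s = M then M' else h s) + (M - M') * (if s ∈ Finset.univ.filter (fun s => h s = M) then (1 : R) else 0)
    simp only [Finset.mem_filter, Finset.mem_univ, true_and]
    by_cases hs : h s = M
    · rw [if_pos hs, if_pos hs, hs]; ring
    · rw [if_neg hs, if_neg hs]; ring

/-- Layer cake, one side: the W-form against an upper-set indicator is nonnegative on monotone
functions as soon as it is nonnegative on pairs of upper-set indicators. -/
lemma Q_ind_nonneg_of_upperSets {W : α → R}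
    (hQ : ∀ U V : Finset α, IsUpperSet (↑U : Set α) → IsUpperSet (↑V : Set α) →
      0 ≤ Q D W (ind U) (ind V)) :
    ∀ n : ℕ, ∀ U : Finset α, IsUpperSet (↑U : Set α) → ∀ h : α → R, Monotone h →
      (Finset.univ.image h).card ≤ n → 0 ≤ Q D W (ind U) h := by
  intro n
  induction n with
  | zero =>
    intro U _ h _ hc
    rw [Q_eq_zero_of_card_le_one W (ind U) h (by omega)]
  | succ n ih =>
    intro U hU h hh hc
    by_cases h1 : (Finset.univ.image h).card ≤ 1
    · rw [Q_eq_zero_of_card_le_one W (ind U) h h1]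
    · obtain ⟨h', c, V, hh', hcard, hcpos, hV, hdec⟩ := layer_step hh (by omega)
      rw [show h = fun s => h' s + c * ind V s from funext hdec, Q_add_right, Q_smul_right]
      exact add_nonneg (ih U hU h' hh' (by omega)) (mul_nonneg hcpos.le (hQ U V hU hV))

/-- Layer cake, both sides. -/
lemma Q_nonneg_of_upperSets {W : α → R}
    (hQ : ∀ U V : Finset α, IsUpperSet (↑U : Set α) → IsUpperSet (↑V : Set α) →
      0 ≤ Q D W (ind U) (ind V)) :
    ∀ n : ℕ, ∀ g : α → R, Monotone g → (Finset.univ.image g).card ≤ n →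
      ∀ h : α → R, Monotone h → 0 ≤ Q D W g h := by
  intro n
  induction n with
  | zero =>
    intro g _ hc h _
    rw [Q_comm, Q_eq_zero_of_card_le_one W h g (by omega)]
  | succ n ih =>
    intro g hg hc h hh
    by_cases h1 : (Finset.univ.image g).card ≤ 1
    · rw [Q_comm, Q_eq_zero_of_card_le_one W h g h1]
    · obtain ⟨g', c, U, hg', hcard, hcpos, hU, hdec⟩ := layer_step hg (by omega)
      rw [show g = fun s => g' s + c * ind U s from funext hdec, Q_comm, Q_add_right, Q_smul_right,
        Q_comm, Q_comm (W := W) (g := h) (h := ind U)]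
      exact add_nonneg (ih g' hg' (by omega) h hh)
        (mul_nonneg hcpos.le (Q_ind_nonneg_of_upperSets hQ _ U hU h hh le_rfl))

/-- **The up-set form of the W-inequality implies the monotone form**: `WIneq D W` follows from
nonnegative weights and `Q(1_U, 1_V) ≥ 0` for all upper sets `U, V` (layer cake). Together with
`wIneq_upperSet` the two forms are equivalent. -/
theorem wIneq_of_upperSets {W : α → R} (hW : ∀ s, 0 ≤ W s)
    (hQ : ∀ U V : Finset α, IsUpperSet (↑U : Set α) → IsUpperSet (↑V : Set α) →
      0 ≤ Q D W (ind U) (ind V)) : WIneq D W :=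
  ⟨hW, fun g h hg hh => Q_nonneg_of_upperSets hQ _ g hg le_rfl h hh⟩

end LayerCake

end Summit.Ventures.PercRepro2.WForm
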